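import Summits.QuantumFields.YangMills.Theorems.FluctuationComparisonRegPrIntLS2BetaTopLadderIntraBlock
import HarnessLib

/-!
# S2β · (LIFT-V) §4 — THE TREE-TRIVIAL FACTOR `ε = (A_W·A_U⁻¹·U)⁻¹·W` IS A PURE LADDER OF SOURCES: `dist1 (ε⟨y,e⟩) ≤ (Σ_{ν<e}|(y − c_B)_ν|)·ρ̃` inside a block
# (px5 ✓`…TopLadderIntraBlock.dist1_chord_le_of_intraBlock` instantiated with the pair `(W̃, W)`, `W̃ := A_W·A_U⁻¹·U`, which AGREES WITH `W` on every tree-comb bond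
# where both towers sit on their lifts — UV3-NODE §102.9 (c); any torus in standing range, any `GaugeGroup`)

Cell `ym3-torus` (rung R3 = continuum `SU(2)` Yang–Mills on the three-torus — NOT d = 4, NOT infinite volume, NOT a mass gap, NOT Clay).
Width seat «width 21» `ym3-torus-px21` (gen 24); `--kind proof --supports stmt-QuantumFields-20520 --as helper`, count-neutral, DEFINITION-FREE
(0 `def`, 0 `instance`, 0 `notation`, 0 `sorry`, default heartbeats); generic `P : Params` (`j + 1 ≤ m + K`), ANY `GaugeGroup G`.

WHY.  In the factorisation `η = U⁻¹W = Ad_{δ_U⁻¹}(R)·ε` (✓∕⧗`…RelativeLiftFactorisation`, §102.9) the `V → V` coefficient is carried by the relative lift `R` alone;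
the factor `ε := (A_W·(A_U⁻¹·U))⁻¹·W` equals `1` on every bond where `U = A_U` and `W = A_W` — by (T4) every TREE-COMB bond of the block — so the two fine
fields `W̃ := A_W·A_U⁻¹·U` and `W` agree on the block's tree comb, and px5's intra-block ladder lemma bounds EVERY in-block chord of the pair `(W̃, W)`, i.e.
`ε`, by `(Σ_{ν<e}|rel|)·ρ̃ ≤ (e(L−1)∕2)·ρ̃`, `ρ̃` := the relative plaquettes of `(W̃, W)` on the block (a SOURCE: `ρ_t` + the relative lift's curvature and
variation around one plaquette — px12's curvature letters; not bounded here).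
* ★★★ `dist1_eps_le_of_intraBlock` — hypotheses: the tree agreement of BOTH towers with their lifts on the tree-comb bonds of `B` (`hU`, `hW`: the (T4) readings),
  `hρ : ∀ q, blockOf q.src = B → dist1 ((□_{W̃} q)⁻¹·□_W q) ≤ ρ̃`; conclusion for every in-block bond `⟨y,e⟩`:
  `dist1 ((A_W⟨y,e⟩·((A_U⟨y,e⟩)⁻¹·U⟨y,e⟩))⁻¹·W⟨y,e⟩) ≤ (Σ_{ν<e} |rel (emb B) y ν|)·ρ̃`; ★ `dist1_eps_le_of_intraBlock'` — `≤ (e·((L−1)∕2))·ρ̃`.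

HONEST SCOPE.  An instantiation of px5's lattice lemma; nothing of Bałaban's analysis is asserted or proved; `ρ̃`'s bound, the face-crossing bonds, the READ′
aggregation, (SCT′₂)'s budget, (SCT′₁₃)∕COMB-ROW′∕NC-ROW′∕(TOP-LAD′)∕(ST′)'s discharge∕LOC∕D-GUARD∕GAP♯∘ (`stub_uniformFibreGapOrbit`, registry untouched, 0∕5), S2β,
crux 20520 and `YM3TorusSU2` are NOT proved; no registered stub is closed; rung R3 — NOT d = 4, NOT infinite volume, NOT a mass gap, NOT Clay; the Yang–Mills
mass gap is NOT proved.
References: T. Bałaban, CMP **122** (1989) 355–392 [Balaban1989LargeFieldII] (p.382: tree-gauge bonds as products of plaquette variables along the comb);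
CMP **98** (1985) 17–51 [Balaban1985Averaging] (p.24, the comb contours); CMP **99** (1985) 75–102 [Balaban1985RegularSpaces] ((1.19) p.79, (1.29) p.81).
-/

set_option autoImplicit false

namespace Summit.QuantumFields.YangMills.Theorems.FluctuationComparisonRegPrIntLS2BetaRelativeLiftFactorisationEps

open Literature.MathematicalPhysics.QuantumFieldTheory.Balaban1983to89
open Literature.MathematicalPhysics.QuantumFieldTheory.Balaban1983to89.BlockAveraging
open B10Eq27TorusAxialLog (rel)
open Summit.QuantumFields.YangMills.Theorems.FluctuationComparisonRegPrIntLS2BetaTopLadderIntraBlock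
  (dist1_chord_le_of_intraBlock dist1_chord_le_of_intraBlock')

variable {P : Params} {j : ℕ} {G : Type*} [GaugeGroup G]

/-- ★★★ **`ε` IS A LADDER OF SOURCES**: if on every tree-comb bond of the block `B` both towers sit on their lifts (`U = A_U`, `W = A_W`), and the relative
plaquettes of the pair `(W̃, W)`, `W̃ := A_W·A_U⁻¹·U`, with source in `B` are `≤ ρ̃`, then for every in-block bond `⟨y,e⟩`
`dist1 ((A_W⟨y,e⟩·((A_U⟨y,e⟩)⁻¹·U⟨y,e⟩))⁻¹·W⟨y,e⟩) ≤ (Σ_{ν<e} |rel (emb B) y ν|)·ρ̃`.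
[cite: Balaban1989LargeFieldII, p.382; Balaban1985Averaging, p.24; Balaban1985RegularSpaces, (1.19) p.79] -/
theorem dist1_eps_le_of_intraBlock (hj : j + 1 ≤ P.m + P.K) (AU AW U W : GaugeField P j G) (B : Site P (j + 1))
    (hU : ∀ (x : Site P j) (μ : Fin P.d), blockOf x = B → blockOf (x.shift μ) = B → (∀ ν, ν < μ → rel (emb B) x ν = 0) → U ⟨x, μ⟩ = AU ⟨x, μ⟩)
    (hW : ∀ (x : Site P j) (μ : Fin P.d), blockOf x = B → blockOf (x.shift μ) = B → (∀ ν, ν < μ → rel (emb B) x ν = 0) → W ⟨x, μ⟩ = AW ⟨x, μ⟩)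
    {ρ : ℝ} (hρ0 : 0 ≤ ρ)
    (hρ : ∀ q : Plaq P j, blockOf q.src = B →
      dist1 ((GaugeField.plaqHol (fun b => AW b * ((AU b)⁻¹ * U b) : GaugeField P j G) q)⁻¹ * GaugeField.plaqHol W q) ≤ ρ)
    (y : Site P j) (e' : Fin P.d) (hy : blockOf y = B) (hye : blockOf (y.shift e') = B) :
    dist1 ((AW ⟨y, e'⟩ * ((AU ⟨y, e'⟩)⁻¹ * U ⟨y, e'⟩))⁻¹ * W ⟨y, e'⟩) ≤
      (∑ ν ∈ Finset.univ.filter (fun ν => ν < e'), ((rel (emb B) y ν).natAbs : ℝ)) * ρ := by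
  have htree : ∀ (x : Site P j) (μ : Fin P.d), blockOf x = B → blockOf (x.shift μ) = B → (∀ ν, ν < μ → rel (emb B) x ν = 0) →
      W ⟨x, μ⟩ = (fun b => AW b * ((AU b)⁻¹ * U b) : GaugeField P j G) ⟨x, μ⟩ := by
    intro x μ hx hxs hlo
    show W ⟨x, μ⟩ = AW ⟨x, μ⟩ * ((AU ⟨x, μ⟩)⁻¹ * U ⟨x, μ⟩)
    rw [hU x μ hx hxs hlo, hW x μ hx hxs hlo, inv_mul_cancel, mul_one]
  have h := dist1_chord_le_of_intraBlock hj W (fun b => AW b * ((AU b)⁻¹ * U b) : GaugeField P j G) B htree hρ0 hρ y e' hy hye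
  simpa using h

/-- ★ The crude form: `≤ (e·((L−1)∕2))·ρ̃`. [cite: Balaban1989LargeFieldII, p.382] -/
theorem dist1_eps_le_of_intraBlock' (hj : j + 1 ≤ P.m + P.K) (AU AW U W : GaugeField P j G) (B : Site P (j + 1))
    (hU : ∀ (x : Site P j) (μ : Fin P.d), blockOf x = B → blockOf (x.shift μ) = B → (∀ ν, ν < μ → rel (emb B) x ν = 0) → U ⟨x, μ⟩ = AU ⟨x, μ⟩)
    (hW : ∀ (x : Site P j) (μ : Fin P.d), blockOf x = B → blockOf (x.shift μ) = B → (∀ ν, ν < μ → rel (emb B) x ν = 0) → W ⟨x, μ⟩ = AW ⟨x, μ⟩)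
    {ρ : ℝ} (hρ0 : 0 ≤ ρ)
    (hρ : ∀ q : Plaq P j, blockOf q.src = B →
      dist1 ((GaugeField.plaqHol (fun b => AW b * ((AU b)⁻¹ * U b) : GaugeField P j G) q)⁻¹ * GaugeField.plaqHol W q) ≤ ρ)
    (y : Site P j) (e' : Fin P.d) (hy : blockOf y = B) (hye : blockOf (y.shift e') = B) :
    dist1 ((AW ⟨y, e'⟩ * ((AU ⟨y, e'⟩)⁻¹ * U ⟨y, e'⟩))⁻¹ * W ⟨y, e'⟩) ≤ ((e'.val * ((P.L - 1) / 2) : ℕ) : ℝ) * ρ := by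
  have htree : ∀ (x : Site P j) (μ : Fin P.d), blockOf x = B → blockOf (x.shift μ) = B → (∀ ν, ν < μ → rel (emb B) x ν = 0) →
      W ⟨x, μ⟩ = (fun b => AW b * ((AU b)⁻¹ * U b) : GaugeField P j G) ⟨x, μ⟩ := by
    intro x μ hx hxs hlo
    show W ⟨x, μ⟩ = AW ⟨x, μ⟩ * ((AU ⟨x, μ⟩)⁻¹ * U ⟨x, μ⟩)
    rw [hU x μ hx hxs hlo, hW x μ hx hxs hlo, inv_mul_cancel, mul_one]
  have h := dist1_chord_le_of_intraBlock' hj W (fun b => AW b * ((AU b)⁻¹ * U b) : GaugeField P j G) B htree hρ0 hρ y e' hy hye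
  simpa using h

end Summit.QuantumFields.YangMills.Theorems.FluctuationComparisonRegPrIntLS2BetaRelativeLiftFactorisationEps
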